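import Literature.AnabelianGeometry.EtaleTheta.Discharge.Sec2DiscreteRigidityLevels

/-!
# [EtTh] §2 discharge: Corollary 2.18 (iv), last clause — `Aut^μ(M_{M'}) → Aut^μ(M_M)` is a
# bijection when `M'/M` is odd (proof-only companion of `ThetaSystems.lean`)

Mochizuki, *The Étale Theta Function and its Frobenioid-theoretic Manifestations* [EtTh],
Publ. RIMS 45 (2009), §2, Cor 2.18 (iv) pp.61–63: "the mod `M` mono-theta environment `M_M`
determined by `M` induces a natural homomorphism `Aut^μ(M) → Aut^μ(M_M)` … whose kernel and
cokernel have the same cardinalities [≤ 2], respectively, as the kernel and cokernel of the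
homomorphism `Hom(ℤ/2ℤ, ℤ/Nℤ) → Hom(ℤ/2ℤ, ℤ/Mℤ)` … [hence is a bijection if `N/M` is odd]"; proof
p.63: "it follows immediately from this description of `Ker(Aut^μ(M•) → Aut(Π•_X))`" [= the first
half of (iv): surjectivity onto `Aut(Π•_X)` with fibres the `μ_N`-conjugacy classes of the twists by
`Hom(Π•_Y/Π•_Ÿ, Ker(Π• ↠ Π•_Y))`] (locators `p.N` = PDF pages of the PRIMS text; bib key
`MochizukiEtTh2009`).

PROOF-ONLY companion (no `def`, no new named fact; seat abc-iut-L2-t2, DAG node `EtTh:Cor2.18(iv)`,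
LONG-CHAINS lane C2) of `ThetaSystems.lean` (same seat; nothing there is edited or restated):
`ThetaEnvTower.cor218_iv_bijective_of_odd_of` — the named fact
`ThetaEnvTower.Cor218_iv_bijective_of_odd` HOLDS for every tower satisfying, at the two levels
concerned, the named facts of Cor 2.18 (iii) (`Cor218_iii_quotient`, `Cor218_iii_PiX`) and of the
FIRST half of Cor 2.18 (iv) (`Cor218_iv_surjective`, `Cor218_iv_fibre`, `Cor218_iv_reduction`) —
exactly the printed dependency — together with the interface axiom "`Π^tp_Ÿ ↠ G_K`" (`K = K̈`,
p.39/p.41; `RigidData.augYdd_surjective` of `ThetaRigidity.lean`, which the tower `ThetaEnvTower`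
does not carry and which is therefore an explicit binder here). Route = the printed one made
explicit: (1) an automorphism `α` of `M_M` lies over an automorphism `γ` of `Π^tp_X`
(`Discharge/Sec2IsoLift.lean`), which lifts to `M_{M'}` (Cor 2.18 (iv), surjectivity) and reduces
back to some `α₁` over the same `γ`; (2) `α ∘ α₁⁻¹` is over `id_{Π^tp_Y}`, hence a `μ_M`-conjugate of
a twist by `φ ∈ Hom(Π^tp_Y/Π^tp_Ÿ, μ_M)` (fibres); (3) the arithmetic of "`N/M` odd": the
`2`-torsion of `μ_{M'}` maps ONTO that of `μ_M` and trivially-reducing `2`-torsion is trivial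
(the kernel of `μ_{M'} ↠ μ_M` has odd order `M'/M`), so `φ` lifts to `φ' ∈ Hom(Π^tp_Y/Π^tp_Ÿ, μ_{M'})`
whose twist is an automorphism of `M_{M'}` (fibres, second clause) — surjectivity up to
`μ_M`-conjugacy; (4) conversely an automorphism of `M_{M'}` reducing to a `μ_M`-conjugation is over
`id_{Π^tp_Y}`, so it is `conj(c₁) ∘ twist(φ')`; reducing, `red ∘ φ'` is the coboundary of an element
of `μ_M` fixed by `Π^tp_Ÿ`, hence (as `Π^tp_Ÿ ↠ G_K`) by `Π^tp_Y`, so `red ∘ φ' = 1` and `φ' = 1`.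
HONEST FRAMING: conditional discharge modulo the named facts listed; no side is taken on
[IUTchIII] Cor 3.12; typed ≠ discharged elsewhere.
-/

namespace Literature.AnabelianGeometry.EtaleTheta

universe u

/-! ## `Hom(Π^tp_Y/Π^tp_Ÿ, μ)`: homomorphisms with prescribed value off `Π^tp_Ÿ` -/

namespace ThetaEnvData

variable {N : ℕ+} (T : ThetaEnvData.{u} N)

/-- An element of `Π^tp_Y` squares into the index-`2` subgroup `Π^tp_Ÿ`.
[cite: MochizukiEtTh2009, Cor 2.18(iv) p.63] -/
theorem mul_self_mem_PiYdd (g : T.PiY) : g * g ∈ T.PiYdd.subgroupOf T.PiY :=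
  (Subgroup.mul_mem_iff_of_index_two T.index_PiYdd).mpr Iff.rfl

/-- A homomorphism `Π^tp_Y → μ` killing `Π^tp_Ÿ` takes `2`-torsion values.
[cite: MochizukiEtTh2009, Cor 2.18(iv) p.63] -/
theorem hom_apply_mul_self {μ : Type*} [Group μ] (φ : T.PiY →* μ)
    (hφ : ∀ d : T.PiYdd, φ (T.inclYdd d) = 1) (g : T.PiY) : φ g * φ g = 1 := by
  rw [← map_mul]
  exact hφ ⟨(g * g : T.PiY), Subgroup.mem_subgroupOf.mp (T.mul_self_mem_PiYdd g)⟩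

/-- **`Hom(Π^tp_Y/Π^tp_Ÿ, μ) ≅ μ[2]`, existence half**: every `a ∈ μ` with `a² = 1` is the value off
`Π^tp_Ÿ` of a homomorphism `Π^tp_Y → μ` killing `Π^tp_Ÿ` ("`Hom(Π•_Y/Π•_Ÿ, Ker(Π• ↠ Π•_Y))` … of
cardinality `1` (respectively, `2`)", p.63). [cite: MochizukiEtTh2009, Cor 2.18(iv) p.63] -/
theorem exists_hom_kill_PiYdd {μ : Type*} [CommGroup μ] (a : μ) (ha : a * a = 1) :
    ∃ φ : T.PiY →* μ, (∀ d : T.PiYdd, φ (T.inclYdd d) = 1) ∧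
      ∀ g : T.PiY, g ∉ T.PiYdd.subgroupOf T.PiY → φ g = a := by
  classical
  let H : Subgroup T.PiY := T.PiYdd.subgroupOf T.PiY
  have hH : H.index = 2 := T.index_PiYdd
  let φ : T.PiY →* μ :=
    { toFun := fun p => if p ∈ H then 1 else a
      map_one' := if_pos H.one_mem
      map_mul' := fun p q => by
        by_cases hp : p ∈ H <;> by_cases hq : q ∈ H
        · rw [if_pos hp, if_pos hq, if_pos (H.mul_mem hp hq), one_mul]
        · have hpq : p * q ∉ H := fun h => hq ((H.mul_mem_cancel_left hp).mp h)
          rw [if_pos hp, if_neg hq, if_neg hpq, one_mul]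
        · have hpq : p * q ∉ H := fun h => hp ((H.mul_mem_cancel_right hq).mp h)
          rw [if_neg hp, if_pos hq, if_neg hpq, mul_one]
        · have hpq : p * q ∈ H :=
            (Subgroup.mul_mem_iff_of_index_two hH).mpr ⟨fun h => absurd h hp, fun h => absurd h hq⟩
          rw [if_neg hp, if_neg hq, if_pos hpq, ha] }
  refine ⟨φ, fun d => ?_, fun g hg => ?_⟩
  · exact if_pos (Subgroup.mem_subgroupOf.mpr d.2)
  · exact if_neg hg

end ThetaEnvData

namespace ThetaEnvTower

variable {E : Set ℕ+} (T : ThetaEnvTower.{u} E)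

/-! ## The arithmetic of "`M'/M` odd" on the cyclotomes `μ_{M'} ↠ μ_M` -/

/-- The kernel of `μ_{M'} ↠ μ_M` has cardinality `M'/M`.
[cite: MochizukiEtTh2009, Cor 2.18(iv) p.62] -/
theorem natCard_ker_red (M M' : E) (h : (M : ℕ+) ∣ M') :
    Nat.card (T.red M M' h).ker = (M' : ℕ+) / (M : ℕ+) := by
  have hM' : Nat.card (T.mu M') = (M' : ℕ+) := by rw [Nat.card_eq_fintype_card, T.card_mu M']
  have hM : Nat.card (T.mu M) = (M : ℕ+) := by rw [Nat.card_eq_fintype_card, T.card_mu M]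
  have hq : Nat.card (T.mu M' ⧸ (T.red M M' h).ker) = Nat.card (T.mu M) :=
    Nat.card_congr (QuotientGroup.quotientKerEquivOfSurjective _ (T.red_surjective M M' h)).toEquiv
  have hmul := Subgroup.card_eq_card_quotient_mul_card_subgroup (T.red M M' h).ker
  rw [hq, hM', hM] at hmul
  symm
  exact Nat.div_eq_of_eq_mul_right (PNat.pos _) (by rw [hmul, mul_comm])

/-- For `M'/M` odd, an element of `μ_{M'}` of order dividing `2` that reduces to `1` in `μ_M` is `1`
(the kernel of `μ_{M'} ↠ μ_M` has odd order). [cite: MochizukiEtTh2009, Cor 2.18(iv) p.62] -/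
theorem eq_one_of_mul_self_of_red_eq_one {M M' : E} (h : (M : ℕ+) ∣ M')
    (hodd : Odd ((M' : ℕ+) / (M : ℕ+) : ℕ)) {a : T.mu M'} (ha : a * a = 1)
    (hr : T.red M M' h a = 1) : a = 1 := by
  have hmem : a ∈ (T.red M M' h).ker := hr
  have h1 : orderOf a ∣ Nat.card (T.red M M' h).ker := Subgroup.orderOf_dvd_natCard _ hmem
  rw [T.natCard_ker_red M M' h] at h1
  have h2 : orderOf a ∣ 2 := orderOf_dvd_of_pow_eq_one (by rw [pow_two, ha])
  have : orderOf a = 1 := Nat.eq_one_of_dvd_coprimes (Nat.coprime_two_left.mpr hodd) h2 h1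
  exact orderOf_eq_one_iff.mp this

/-- For `M'/M` odd, every element of `μ_M` of order dividing `2` lifts to an element of `μ_{M'}` of
order dividing `2` (the `2`-torsion of `μ_{M'}` maps onto that of `μ_M`).
[cite: MochizukiEtTh2009, Cor 2.18(iv) p.62] -/
theorem exists_mul_self_eq_one_red_eq {M M' : E} (h : (M : ℕ+) ∣ M')
    (hodd : Odd ((M' : ℕ+) / (M : ℕ+) : ℕ)) {a : T.mu M} (ha : a * a = 1) :
    ∃ a' : T.mu M', a' * a' = 1 ∧ T.red M M' h a' = a := by
  obtain ⟨b, hb⟩ := T.red_surjective M M' h a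
  obtain ⟨m, hm⟩ := hodd
  let k : ℕ := ((M' : ℕ+) / (M : ℕ+) : ℕ)
  have hk : Nat.card (T.red M M' h).ker = k := T.natCard_ker_red M M' h
  have hb2 : b * b ∈ (T.red M M' h).ker := by
    rw [MonoidHom.mem_ker, map_mul, hb, ha]
  have hbk : (b * b) ^ k = 1 := by
    have := pow_card_eq_one' (x := (⟨b * b, hb2⟩ : (T.red M M' h).ker))
    rw [hk] at this
    exact congrArg Subtype.val this
  refine ⟨b ^ k, ?_, ?_⟩
  · rw [← mul_pow, hbk]
  · rw [map_pow, hb]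
    change a ^ ((M' : ℕ+) / (M : ℕ+) : ℕ) = a
    rw [hm, pow_succ, pow_mul, pow_two, ha, one_pow, one_mul]

/-! ## Reduction of the basic automorphisms -/

/-- The reduction carries the cyclotome to the cyclotome: `red(ι(a)) = ι(red a)`.
[cite: MochizukiEtTh2009, Def 2.13(ii) p.48] -/
theorem redEnv_inMu (M M' : E) (h : (M : ℕ+) ∣ M') (a : T.mu M') :
    T.redEnv M M' h (CycEnvelope.inMu (T.level M').augY (T.level M').chi a) =
      CycEnvelope.inMu (T.level M).augY (T.level M).chi (T.red M M' h a) := by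
  ext <;> rfl

/-- The reduction is the identity on the algebraic section: `red(s^alg(p)) = s^alg(p)`.
[cite: MochizukiEtTh2009, Def 2.13(ii) p.48] -/
theorem redEnv_algSection (M M' : E) (h : (M : ℕ+) ∣ M') (p : T.PiY) :
    T.redEnv M M' h (CycEnvelope.algSection (T.level M').augY (T.level M').chi p) =
      CycEnvelope.algSection (T.level M).augY (T.level M).chi p := by
  ext
  · exact map_one _
  · rfl

end ThetaEnvTower

namespace ThetaEnvData

variable {N : ℕ+} (D : ThetaEnvData.{u} N)

/-- The `μ`-coordinate of `ι(c) · (ι(a) · s^alg(p)) · ι(c)⁻¹` is `c · a · (p·c)⁻¹`.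
[cite: MochizukiEtTh2009, Cor 2.18(iv) p.63] -/
theorem left_conj_inMu_twist_algSection (c a : D.mu) (p : D.PiY) :
    (MulAut.conj (CycEnvelope.inMu D.augY D.chi c)
        (CycEnvelope.inMu D.augY D.chi a * CycEnvelope.algSection D.augY D.chi p)).left =
      c * a * (D.chi (D.augY p) c)⁻¹ := by
  rw [MulAut.conj_apply]
  simp only [SemidirectProduct.mul_left, SemidirectProduct.left_inl, SemidirectProduct.right_inl,
    map_one, MulAut.one_apply, SemidirectProduct.left_inr, mul_one, SemidirectProduct.mul_right,
    SemidirectProduct.right_inr, one_mul, SemidirectProduct.inv_left, map_inv, MonoidHom.coe_comp,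
    Function.comp_apply]
  simp

/-- The `μ`-coordinate of `ι(c) · s^alg(p) · ι(c)⁻¹` is the coboundary value `c · (p·c)⁻¹` ("conjugation
by an element of `μ_N` corresponds precisely to modifying a cocycle by a coboundary", p.47).
[cite: MochizukiEtTh2009, Def 2.13(i) p.47] -/
theorem left_conj_inMu_algSection (c : D.mu) (p : D.PiY) :
    (MulAut.conj (CycEnvelope.inMu D.augY D.chi c) (CycEnvelope.algSection D.augY D.chi p)).left =
      c * (D.chi (D.augY p) c)⁻¹ := by
  have := D.left_conj_inMu_twist_algSection c 1 p
  rwa [map_one, one_mul, mul_one] at this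

/-- `μ`-conjugation does not move the `Π^tp_Y`-coordinate of `s^alg(p)`.
[cite: MochizukiEtTh2009, Def 2.13(i) p.47] -/
theorem right_conj_inMu_algSection (c : D.mu) (p : D.PiY) :
    (MulAut.conj (CycEnvelope.inMu D.augY D.chi c) (CycEnvelope.algSection D.augY D.chi p)).right =
      p := by
  rw [MulAut.conj_apply]
  simp

end ThetaEnvData

/-- Solving `r · x · (s r)⁻¹ = c · (s c)⁻¹` for `x` in a commutative group: `x` is the coboundary value
of `c · r⁻¹`. [cite: MochizukiEtTh2009, Cor 2.18(iv) p.63] -/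
theorem eq_coboundary_of_conj_eq {A : Type*} [CommGroup A] (s : MulAut A) {r x c : A}
    (h : r * x * (s r)⁻¹ = c * (s c)⁻¹) : x = (c * r⁻¹) * (s (c * r⁻¹))⁻¹ := by
  have hx : x = r⁻¹ * (r * x * (s r)⁻¹) * s r := by group
  rw [hx, h, map_mul, map_inv, mul_inv_rev, inv_inv]
  simp only [mul_assoc, mul_comm, mul_left_comm]

namespace ThetaEnvTower

variable {E : Set ℕ+} (T : ThetaEnvTower.{u} E)

/-! ## Corollary 2.18 (iv), last clause -/

/-- **Corollary 2.18 (iv), "[hence is a bijection if `N/M` is odd]" — DISCHARGED modulo Cor 2.18 (iii)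
and the first half of Cor 2.18 (iv).** For every tower whose conjugation action `Π^tp_X ↷ Π^tp_Y` is
faithful (`hslim` = `Cor218_iii_PiX`), with `Ker(Π• ↠ Π•_Y)` = union of centralisers at the levels
`M, M'` (`hq` = `Cor218_iii_quotient`), satisfying the named facts `Cor218_iv_surjective` (lifting),
`Cor218_iv_fibre` (fibres = `μ`-conjugates of the twists by `Hom(Π•_Y/Π•_Ÿ, μ)`, and conversely) and
`Cor218_iv_reduction`, and with `Π^tp_Ÿ ↠ G_K` (`haug`, the interface axiom
`RigidData.augYdd_surjective`, p.41), the named fact `Cor218_iv_bijective_of_odd` holds: for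
`M ∣ M'` in `E` with `M'/M` odd, `Aut^μ(M_{M'}) → Aut^μ(M_M)` is onto (up to `μ_M`-conjugacy) and has
trivial kernel (modulo `μ_{M'}`-conjugacy). [cite: MochizukiEtTh2009, Cor 2.18(iv) p.62] -/
theorem cor218_iv_bijective_of_odd_of
    (hslim : ∀ x : T.PiX, (∀ h : T.PiY, x * h * x⁻¹ = h) → x = 1)
    (hq : ∀ M : E, centralizerUnion (T.level M).env =
      (CycEnvelope.proj (T.level M).augY (T.level M).chi).ker)
    (hlift : ∀ M : E, (T.level M).Cor218_iv_surjective)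
    (hfib : ∀ M : E, (T.level M).Cor218_iv_fibre) (hred : T.Cor218_iv_reduction)
    (haug : Function.Surjective (T.aug.comp T.PiYdd.subtype)) :
    T.Cor218_iv_bijective_of_odd := by
  intro M M' h hodd η' hη' hη
  -- automorphisms of a level preserve `Ker(Π_Y[μ] ↠ Π_Y)` (Cor 2.18 (iii) / Prop 2.11 (ii))
  have hker : ∀ (L : E) (η : T.PiYdd → T.mu L) (hηL : η ∈ T.thetaCocycles L)
      (α : ((T.level L).modelMono hηL).Iso ((T.level L).modelMono hηL)),
      ((CycEnvelope.proj (T.level L).augY (T.level L).chi).ker).map α.e.toMulEquiv.toMonoidHom =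
        (CycEnvelope.proj (T.level L).augY (T.level L).chi).ker := fun L η hηL α => by
    rw [← hq L]; exact map_centralizerUnion_eq α.e
  refine ⟨fun α => ?_, fun α' c hR => ?_⟩
  · /- SURJECTIVITY up to `μ_M`-conjugacy -/
    -- (1) `α` lies over an automorphism `γ` of `Π^tp_X`; lift `γ` to `M_{M'}`, reduce back to `α₁`
    obtain ⟨γ, hγ⟩ := ThetaEnvData.exists_continuousMulEquiv_PiX_of_iso α (hker M _ hη α) hslim
    obtain ⟨α₁', hα₁'⟩ := hlift M' η' hη' γ (T.map_PiY_eq_of_over α.e.toMulEquiv γ hγ)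
    have hα₁'r : ∀ x, ((α₁'.e.toMulEquiv x).right : T.PiX) = γ (x.right : T.PiX) := hα₁'
    obtain ⟨α₁, hα₁⟩ := hred M M' h η' hη' α₁'
    have hγ₁ : ∀ y, ((α₁.e.toMulEquiv y).right : T.PiX) = γ (y.right : T.PiX) :=
      fun y => right_eq_of_reduces hα₁ hα₁'r y
    -- (2) `β' := α ∘ α₁⁻¹` is over `id_{Π^tp_Y}`: a `μ_M`-conjugate of the twist by some `φ`
    obtain ⟨α₁s, hα₁s⟩ := ThetaEnvData.exists_iso_symm α₁
    obtain ⟨β', hβ'⟩ := ThetaEnvData.exists_iso_trans α₁s α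
    have hβ'id : ∀ x, CycEnvelope.proj (T.level M).augY (T.level M).chi (β'.e x) =
        CycEnvelope.proj (T.level M).augY (T.level M).chi x := by
      intro x
      apply Subtype.ext
      change (((β'.e x).right : T.PiY) : T.PiX) = (x.right : T.PiX)
      have h3 : (((α₁.e.symm x).right : T.PiY) : T.PiX) = γ.symm (x.right : T.PiX) :=
        T.over_symm α₁.e.toMulEquiv γ hγ₁ x
      rw [hβ', hα₁s, hγ, h3, ContinuousMulEquiv.apply_symm_apply]
    obtain ⟨φ, hφ, c, hc⟩ := (hfib M _ hη).1 β' hβ'id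
    -- (3) the arithmetic: lift `φ` to `φ' ∈ Hom(Π^tp_Y/Π^tp_Ÿ, μ_{M'})` with `red ∘ φ' = φ`
    obtain ⟨g₀, hg₀⟩ := (T.level M).exists_not_mem_PiYdd
    obtain ⟨a', ha'2, ha'red⟩ :=
      T.exists_mul_self_eq_one_red_eq h hodd ((T.level M).hom_apply_mul_self φ hφ g₀)
    obtain ⟨φ', hφ', hφ'g₀⟩ := (T.level M').exists_hom_kill_PiYdd a' ha'2
    have hredφ' : ∀ p : T.PiY, T.red M M' h (φ' p) = φ p := by
      have key := (T.level M).hom_eq_of_apply_eq (φ₁ := (T.red M M' h).comp φ') (φ₂ := φ)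
        (fun d => by
          change T.red M M' h (φ' ((T.level M').inclYdd d)) = 1
          rw [hφ' d, map_one]) hφ hg₀ (by
          change T.red M M' h (φ' g₀) = φ g₀
          rw [hφ'g₀ g₀ hg₀, ha'red])
      intro p
      exact DFunLike.congr_fun key p
    -- the twist by `φ'` IS an automorphism `α₂'` of `M_{M'}` (fibres, second clause) …
    obtain ⟨α₂', hα₂'⟩ := (hfib M' η' hη').2 φ' hφ'
    -- … reducing to the twist `tw := conj(ι c)⁻¹ ∘ β'` by `φ`
    let tw : MulAut (T.level M).env :=
      (MulAut.conj (CycEnvelope.inMu (T.level M).augY (T.level M).chi c))⁻¹ * β'.e.toMulEquiv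
    have htw : ∀ y, tw y = CycEnvelope.inMu (T.level M).augY (T.level M).chi
        (φ (CycEnvelope.proj (T.level M).augY (T.level M).chi y)) * y := by
      intro y
      change (MulAut.conj (CycEnvelope.inMu (T.level M).augY (T.level M).chi c))⁻¹
        (β'.e y) = _
      rw [MulAut.inv_apply, MulEquiv.symm_apply_eq]
      exact hc y
    have hR2 : T.Reduces h α₂'.e.toMulEquiv tw := by
      intro x
      change T.redEnv M M' h (α₂'.e x) = tw (T.redEnv M M' h x)
      rw [hα₂' x, htw, map_mul, T.redEnv_inMu, hredφ']
      rfl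
    -- (4) `α' := α₂' ∘ α₁'` reduces to `tw ∘ α₁ = conj(ι c⁻¹) ∘ α`
    have hR12 : T.Reduces h (α₂'.e.toMulEquiv * α₁'.e.toMulEquiv) (tw * α₁.e.toMulEquiv) :=
      reduces_mul hR2 hα₁
    obtain ⟨δ, hδ⟩ := ThetaEnvData.exists_iso_trans α₁' α₂'
    have htwα : tw * α₁.e.toMulEquiv =
        MulAut.conj (CycEnvelope.inMu (T.level M).augY (T.chi M) c⁻¹) *
          (α.e.toMulEquiv : MulAut (T.level M).env) := by
      apply MulEquiv.ext
      intro y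
      change (MulAut.conj (CycEnvelope.inMu (T.level M).augY (T.level M).chi c))⁻¹
          (β'.e (α₁.e y)) = MulAut.conj (CycEnvelope.inMu (T.level M).augY (T.level M).chi c⁻¹) (α.e y)
      rw [map_inv, map_inv, hβ', hα₁s, ContinuousMulEquiv.symm_apply_apply]
    refine ⟨δ, c⁻¹, ?_⟩
    rw [← htwα]
    intro x
    rw [← hR12 x]
    exact congrArg (T.redEnv M M' h) (hδ x)
  · /- TRIVIAL KERNEL modulo `μ_{M'}`-conjugacy -/
    -- (1) `α'` lies over some `γ'`, which is the identity on `Π^tp_Y` since `α'` reduces to `conj(ι c)`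
    obtain ⟨γ', hγ'⟩ := ThetaEnvData.exists_continuousMulEquiv_PiX_of_iso α' (hker M' η' hη' α') hslim
    have hα'r : ∀ x, ((α'.e.toMulEquiv x).right : T.PiX) = γ' (x.right : T.PiX) := hγ'
    have hγ'id : ∀ p : T.PiY, γ' (p : T.PiX) = p := by
      intro p
      have e := right_eq_of_reduces hR hα'r
        (CycEnvelope.algSection (T.level M).augY (T.level M).chi p)
      rw [ThetaEnvData.right_conj_inMu_algSection] at e
      exact e.symm
    have hid' : ∀ x, CycEnvelope.proj (T.level M').augY (T.level M').chi (α'.e x) =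
        CycEnvelope.proj (T.level M').augY (T.level M').chi x := by
      intro x
      apply Subtype.ext
      change (((α'.e x).right : T.PiY) : T.PiX) = (x.right : T.PiX)
      rw [hγ', hγ'id]
    -- (2) so `α' = conj(ι c₁) ∘ twist(φ')` (fibres, first clause)
    obtain ⟨φ', hφ', c₁, hc₁⟩ := (hfib M' η' hη').1 α' hid'
    -- (3) reducing: `red ∘ φ'` is the coboundary of `d := c · (red c₁)⁻¹`
    have key : ∀ p : T.PiY, T.red M M' h (φ' p) =
        (c * (T.red M M' h c₁)⁻¹) * (T.chi M (T.aug (p : T.PiX)) (c * (T.red M M' h c₁)⁻¹))⁻¹ := by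
      intro p
      have e1 : (T.redEnv M M' h (α'.e (CycEnvelope.algSection (T.level M').augY (T.level M').chi p))).left =
          (MulAut.conj (CycEnvelope.inMu (T.level M).augY (T.level M).chi c)
            (CycEnvelope.algSection (T.level M).augY (T.level M).chi p)).left :=
        congrArg SemidirectProduct.left ((hR _).trans (congrArg _ (T.redEnv_algSection M M' h p)))
      rw [hc₁, T.left_redEnv, ThetaEnvData.left_conj_inMu_twist_algSection,
        ThetaEnvData.left_conj_inMu_algSection, map_mul, map_mul, map_inv] at e1
      have hrc : T.red M M' h ((T.level M').chi ((T.level M').augY p) c₁) =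
          T.chi M (T.aug (p : T.PiX)) (T.red M M' h c₁) := T.red_chi M M' h _ _
      rw [hrc] at e1
      exact eq_coboundary_of_conj_eq (T.chi M (T.aug (p : T.PiX))) e1
    -- `Π^tp_Ÿ` kills `φ'`, so it fixes `d`; as `Π^tp_Ÿ ↠ G_K`, all of `G_K` fixes `d`, so `red ∘ φ' = 1`
    have hfixdd : ∀ q : T.PiYdd,
        T.chi M (T.aug (q : T.PiX)) (c * (T.red M M' h c₁)⁻¹) = c * (T.red M M' h c₁)⁻¹ := by
      intro q
      have e := key ((T.level M').inclYdd q)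
      rw [hφ' q, map_one] at e
      have e' := eq_mul_inv_iff_mul_eq.mp e
      rw [one_mul] at e'
      exact e'
    have hfixG : ∀ g : T.G, T.chi M g (c * (T.red M M' h c₁)⁻¹) = c * (T.red M M' h c₁)⁻¹ := by
      intro g
      obtain ⟨q, rfl⟩ := haug g
      exact hfixdd q
    have hredφ'1 : ∀ p : T.PiY, T.red M M' h (φ' p) = 1 := fun p => by
      rw [key p, hfixG, mul_inv_cancel]
    -- (4) the `2`-torsion value `φ'(g₀)` reduces to `1`, hence is `1` (`M'/M` odd): `φ' = 1`
    obtain ⟨g₀, hg₀⟩ := (T.level M').exists_not_mem_PiYdd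
    have ha'1 : φ' g₀ = 1 :=
      T.eq_one_of_mul_self_of_red_eq_one h hodd ((T.level M').hom_apply_mul_self φ' hφ' g₀)
        (hredφ'1 g₀)
    have hφ'1 : φ' = 1 :=
      (T.level M').hom_eq_of_apply_eq (φ₁ := φ') (φ₂ := 1) hφ' (fun _ => rfl) hg₀
        (by rw [ha'1]; rfl)
    refine ⟨c₁, MulEquiv.ext fun x => ?_⟩
    change α'.e x = _
    rw [hc₁ x, hφ'1, MonoidHom.one_apply, map_one, one_mul]

/-- **Corollary 2.18 (iv), last clause — DISCHARGED modulo the NAMED level-wise facts** `Cor218_iii_PiX`,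
`Cor218_iii_quotient`, `Cor218_iv_surjective`, `Cor218_iv_fibre` (`ThetaRigidityLevels.lean`),
`Cor218_iv_reduction`, and `Π^tp_Ÿ ↠ G_K`. [cite: MochizukiEtTh2009, Cor 2.18(iv) p.62] -/
theorem cor218_iv_bijective_of_odd_of_levels (hP : ∀ M : E, (T.level M).Cor218_iii_PiX)
    (hq : ∀ M : E, (T.level M).Cor218_iii_quotient)
    (hlift : ∀ M : E, (T.level M).Cor218_iv_surjective)
    (hfib : ∀ M : E, (T.level M).Cor218_iv_fibre) (hred : T.Cor218_iv_reduction)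
    (haug : Function.Surjective (T.aug.comp T.PiYdd.subtype)) :
    T.Cor218_iv_bijective_of_odd :=
  T.cor218_iv_bijective_of_odd_of (hP ⟨1, T.one_mem⟩) hq hlift hfib hred haug

/-- **Corollary 2.18 (iv), last clause — DISCHARGED modulo temp-slimness of `Π^tp_X`** ([SemiAnbd]
Ex. 3.10, which yields both Cor 2.18 (iii) inputs, `cor218_iii_of_tempSlim`) **and the named facts**
`Cor218_iv_surjective`, `Cor218_iv_fibre`, `Cor218_iv_reduction`, `Π^tp_Ÿ ↠ G_K`.
[cite: MochizukiEtTh2009, Cor 2.18(iv) p.62] -/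
theorem cor218_iv_bijective_of_odd_of_tempSlim
    (hts : ∀ U : Subgroup T.PiX, IsOpen (U : Set T.PiX) →
      ∀ z : T.PiX, (∀ u ∈ U, z * u = u * z) → z = 1)
    (hlift : ∀ M : E, (T.level M).Cor218_iv_surjective)
    (hfib : ∀ M : E, (T.level M).Cor218_iv_fibre) (hred : T.Cor218_iv_reduction)
    (haug : Function.Surjective (T.aug.comp T.PiYdd.subtype)) :
    T.Cor218_iv_bijective_of_odd :=
  T.cor218_iv_bijective_of_odd_of (T.cor218_iii_of_tempSlim hts).1 (T.cor218_iii_of_tempSlim hts).2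
    hlift hfib hred haug

end ThetaEnvTower

end Literature.AnabelianGeometry.EtaleTheta
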